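import Literature.MathematicalPhysics.QuantumFieldTheory.PinnedOneLinkLaplaceMorsePrep
import HarnessLib

/-!
# Morse bounds for the exponent of a strongly pinned one-link law at its minimiser

Fourth file of the proof of the named fact
`Literature.MathematicalPhysics.QuantumFieldTheory.OneLinkLaplaceConcentration`
(`PinnedOneLinkLaplace.lean`). After dividing by `s` and re-centring at a minimiser, the exponent of
a strongly pinned one-link law is, on the compact matrix group `H = ρ(G) ⊆ U(N)`, a function
`Φ(X) = -Re tr(A X) - ε W(X)` (`A ∈ H`, `ε = β/s`, `W` the staple perturbation) which attains its
minimum over `H` at `X = 1`. We prove the two-sided quadratic bounds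

  `a ‖X - 1‖_F² ≤ Φ(X) - Φ(1) ≤ 2 ‖X - 1‖_F²`  for all `X ∈ H`     (`morse_bounds`)

with `a = r²/(16(N+1))` depending only on `N` and on the radius `r` of an exponential chart of `H`
(`Literature.Analysis.Calculus.exists_exp_chart_range`), provided `ε ≤ ε₀(N, r, K)`; here `W` is
any function with a real-linear first-order part at `1` (`|D_W Z| ≤ K₁‖Z‖_F`, remainder
`≤ K₂ ‖X - 1‖_F²` on `U(N)`) and oscillation `≤ K₃` on `U(N)`
(`PinnedOneLinkLaplaceMorsePrep.exists_perturbation_taylor`, `abs_perturbation_sub_le`).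

The proof uses no Hessians and no coordinates on `H`:
* on `U(N)`, `-Re tr(A X) + Re tr A = ½‖X - 1‖_F² - Re tr((A - 1)(X - 1))`, so
  `Φ(X) - Φ(1) = ½‖X - 1‖² + L(X - 1) - ε R_W(X)` with the real-linear functional
  `L = -Re tr((A - 1) ·) - ε D_W` of norm `λ ≤ ‖A - 1‖_F + ε K₁`, and minimality at `Aᴴ ∈ H`
  gives `‖A - 1‖_F² ≤ 2 ε K₃`;
* **upper bound** — minimality at `Xᴴ ∈ H` and the inversion identity
  `Xᴴ - 1 = -(X - 1) - (X - 1)(Xᴴ - 1)` give `L(X - 1) ≤ (½ + λ + εK₂)‖X - 1‖²`;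
* **lower bound near `1`** — for `X = exp Y` in the chart, minimality along the one-parameter
  subgroup `exp(tY) ⊆ H` forces `L(Y) = 0` (first-order squeeze, `‖exp(tY) - 1 - tY‖ = O(t²)`),
  whence `|L(X - 1)| = |L(exp Y - 1 - Y)| ≤ 12 λ ‖X - 1‖²`;
* **lower bound far from `1`** — `Φ(X) - Φ(1) ≥ ½ r² - 2√N ‖A - 1‖_F - ε K₃ ≥ ¼ r²`.

This is the Morse lemma input of the Laplace method (Breitung, LNM 1592, Ch. 5, Thm. 41/44)
obtained from the group structure alone. Matrices carry the Frobenius norm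
(`open scoped Matrix.Norms.Frobenius`). Everything is proved; no definitions.
-/

noncomputable section

open scoped Matrix.Norms.Frobenius Matrix
open Matrix NormedSpace

namespace Literature.MathematicalPhysics.QuantumFieldTheory

variable {N : ℕ}

/-- `√N ≤ N + 1`. [folklore] -/
theorem sqrt_natCast_le_add_one (N : ℕ) : Real.sqrt N ≤ (N : ℝ) + 1 := by
  rw [Real.sqrt_le_iff]
  constructor
  · positivity
  · nlinarith [(Nat.cast_nonneg N : (0 : ℝ) ≤ N)]

/-- `Re tr 1 = N`. [folklore] -/
theorem re_trace_one : (1 : Matrix (Fin N) (Fin N) ℂ).trace.re = N := by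
  rw [Matrix.trace_one]; simp

/-- **Upper Morse bound from minimality at the inverse.** If on `U(N)`
`Φ Y - Φ 1 = ½‖Y - 1‖² + L(Y - 1) - R(Y)` with `|L Z| ≤ λ‖Z‖`, `|R Y| ≤ e‖Y - 1‖²`, `λ + 2e ≤ 1`,
and `Φ 1 ≤ Φ Xᴴ` for a unitary `X`, then `Φ X - Φ 1 ≤ 2‖X - 1‖²` — by the inversion identity
`Xᴴ - 1 = -(X - 1) - (X - 1)(Xᴴ - 1)`. [folklore] -/
theorem morse_upper {Φ R : Matrix (Fin N) (Fin N) ℂ → ℝ} {L : Matrix (Fin N) (Fin N) ℂ →ₗ[ℝ] ℝ}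
    {lam e : ℝ} (hlam : 0 ≤ lam)
    (hId : ∀ Y ∈ Matrix.unitaryGroup (Fin N) ℂ,
      Φ Y - Φ 1 = (1 / 2) * ‖Y - 1‖ ^ 2 + L (Y - 1) - R Y)
    (hL : ∀ Z, |L Z| ≤ lam * ‖Z‖)
    (hR : ∀ Y ∈ Matrix.unitaryGroup (Fin N) ℂ, |R Y| ≤ e * ‖Y - 1‖ ^ 2)
    (hsmall : lam + 2 * e ≤ 1) {X : Matrix (Fin N) (Fin N) ℂ} (hX : X ∈ Matrix.unitaryGroup (Fin N) ℂ)
    (hmin : Φ 1 ≤ Φ Xᴴ) : Φ X - Φ 1 ≤ 2 * ‖X - 1‖ ^ 2 := by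
  have hXs : Xᴴ ∈ Matrix.unitaryGroup (Fin N) ℂ := by
    rw [← Matrix.star_eq_conjTranspose]; exact Unitary.star_mem hX
  have h0 : 0 ≤ Φ Xᴴ - Φ 1 := sub_nonneg.2 hmin
  have hLX' : L (Xᴴ - 1) = -L (X - 1) - L ((X - 1) * (Xᴴ - 1)) := by
    conv_lhs => rw [conjTranspose_sub_one hX]
    rw [map_sub, map_neg]
  rw [hId Xᴴ hXs, hLX', norm_conjTranspose_sub_one] at h0
  have h1 : |L ((X - 1) * (Xᴴ - 1))| ≤ lam * ‖X - 1‖ ^ 2 := by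
    calc |L ((X - 1) * (Xᴴ - 1))| ≤ lam * ‖(X - 1) * (Xᴴ - 1)‖ := hL _
      _ ≤ lam * (‖X - 1‖ * ‖Xᴴ - 1‖) := mul_le_mul_of_nonneg_left (norm_mul_le _ _) hlam
      _ = lam * ‖X - 1‖ ^ 2 := by rw [norm_conjTranspose_sub_one]; ring
  have h2 := hR Xᴴ hXs
  rw [norm_conjTranspose_sub_one] at h2
  have h3 := hR X hX
  rw [hId X hX]
  have hsq : 0 ≤ ‖X - 1‖ ^ 2 := sq_nonneg _
  rw [abs_le] at h1 h2 h3
  nlinarith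

/-- **The first-order squeeze along a one-parameter subgroup.** If on `U(N)`
`Φ Z - Φ 1 = ½‖Z - 1‖² + L(Z - 1) - R(Z)` with `|L Z| ≤ λ‖Z‖`, `|R Z| ≤ e‖Z - 1‖²`, and
`Φ 1 ≤ Φ(exp(tY))` for all real `t` with `exp(tY)` unitary, then `L Y = 0`
(`0 ≤ t L(Y) + O(t²)` for both signs of `t`). [folklore] -/
theorem apply_eq_zero_of_minimal_along {Φ R : Matrix (Fin N) (Fin N) ℂ → ℝ}
    {L : Matrix (Fin N) (Fin N) ℂ →ₗ[ℝ] ℝ} {lam e : ℝ} (hlam : 0 ≤ lam) (he : 0 ≤ e)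
    (hId : ∀ Z ∈ Matrix.unitaryGroup (Fin N) ℂ,
      Φ Z - Φ 1 = (1 / 2) * ‖Z - 1‖ ^ 2 + L (Z - 1) - R Z)
    (hL : ∀ Z, |L Z| ≤ lam * ‖Z‖)
    (hR : ∀ Z ∈ Matrix.unitaryGroup (Fin N) ℂ, |R Z| ≤ e * ‖Z - 1‖ ^ 2)
    {Y : Matrix (Fin N) (Fin N) ℂ} (hYu : ∀ t : ℝ, exp (t • Y) ∈ Matrix.unitaryGroup (Fin N) ℂ)
    (hmin : ∀ t : ℝ, Φ 1 ≤ Φ (exp (t • Y))) : L Y = 0 := by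
  have hC0 : 0 ≤ (8 + 3 * lam + 16 * e) * ‖Y‖ ^ 2 := by positivity
  have key : ∀ s t : ℝ, 0 < t → t ≤ 1 / (‖Y‖ + 1) → |s| = t →
      0 ≤ s * L Y + (8 + 3 * lam + 16 * e) * ‖Y‖ ^ 2 * t ^ 2 := by
    intro s t ht htle hs
    have hns : ‖s • Y‖ = t * ‖Y‖ := by rw [norm_smul, Real.norm_eq_abs, hs]
    have hsY : ‖s • Y‖ ≤ 1 := by
      rw [hns]
      calc t * ‖Y‖ ≤ 1 / (‖Y‖ + 1) * ‖Y‖ := mul_le_mul_of_nonneg_right htle (norm_nonneg _)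
        _ ≤ 1 := by rw [div_mul_eq_mul_div, one_mul, div_le_one (by positivity)]; linarith
    have h0 : 0 ≤ Φ (exp (s • Y)) - Φ 1 := sub_nonneg.2 (hmin s)
    rw [hId _ (hYu s)] at h0
    obtain ⟨hT1, hT2⟩ := norm_exp_sub_one_le hsY
    have hsplit : L (exp (s • Y) - 1) = s * L Y + L (exp (s • Y) - 1 - s • Y) := by
      rw [map_sub L (exp (s • Y) - 1) (s • Y), map_smul, smul_eq_mul]; ring
    have h1 : |L (exp (s • Y) - 1 - s • Y)| ≤ lam * (3 * (t ^ 2 * ‖Y‖ ^ 2)) := by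
      calc |L (exp (s • Y) - 1 - s • Y)| ≤ lam * ‖exp (s • Y) - 1 - s • Y‖ := hL _
        _ ≤ lam * (3 * ‖s • Y‖ ^ 2) := mul_le_mul_of_nonneg_left hT1 hlam
        _ = lam * (3 * (t ^ 2 * ‖Y‖ ^ 2)) := by rw [hns, mul_pow]
    have h2 : ‖exp (s • Y) - 1‖ ^ 2 ≤ 16 * (t ^ 2 * ‖Y‖ ^ 2) := by
      rw [hns] at hT2
      calc ‖exp (s • Y) - 1‖ ^ 2 ≤ (4 * (t * ‖Y‖)) ^ 2 := pow_le_pow_left₀ (norm_nonneg _) hT2 2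
        _ = 16 * (t ^ 2 * ‖Y‖ ^ 2) := by ring
    have h3 := hR _ (hYu s)
    rw [hsplit] at h0
    rw [abs_le] at h1 h3
    nlinarith [mul_le_mul_of_nonneg_left h2 he, mul_le_mul_of_nonneg_left h2 hlam]
  refine eq_zero_of_forall_abs_le_mul (K := (8 + 3 * lam + 16 * e) * ‖Y‖ ^ 2)
    (t₀ := 1 / (‖Y‖ + 1)) hC0 (by positivity) fun t ht htle => ?_
  have k1 := key t t ht htle (abs_of_pos ht)
  have k2 := key (-t) t ht htle (by rw [abs_neg, abs_of_pos ht])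
  rw [abs_le]
  constructor <;> nlinarith

/-- **Lower Morse bound in the exponential chart.** With the identity and bounds as above,
`12λ + e ≤ ¼`, and `X = exp Y` unitary with `L Y = 0`, `‖Y‖ ≤ 2‖X - 1‖`, `‖Y‖ ≤ 1`:
`¼‖X - 1‖² ≤ Φ X - Φ 1` (`|L(X - 1)| = |L(exp Y - 1 - Y)| ≤ 12λ‖X - 1‖²`). [folklore] -/
theorem morse_lower_near {Φ R : Matrix (Fin N) (Fin N) ℂ → ℝ}
    {L : Matrix (Fin N) (Fin N) ℂ →ₗ[ℝ] ℝ} {lam e : ℝ} (hlam : 0 ≤ lam)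
    (hId : ∀ Z ∈ Matrix.unitaryGroup (Fin N) ℂ,
      Φ Z - Φ 1 = (1 / 2) * ‖Z - 1‖ ^ 2 + L (Z - 1) - R Z)
    (hL : ∀ Z, |L Z| ≤ lam * ‖Z‖)
    (hR : ∀ Z ∈ Matrix.unitaryGroup (Fin N) ℂ, |R Z| ≤ e * ‖Z - 1‖ ^ 2)
    (hsmall : 12 * lam + e ≤ 1 / 4) {X Y : Matrix (Fin N) (Fin N) ℂ}
    (hX : X ∈ Matrix.unitaryGroup (Fin N) ℂ) (hYX : exp Y = X) (hYn : ‖Y‖ ≤ 2 * ‖X - 1‖)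
    (hY1 : ‖Y‖ ≤ 1) (hLY : L Y = 0) : (1 / 4) * ‖X - 1‖ ^ 2 ≤ Φ X - Φ 1 := by
  have hLX : |L (X - 1)| ≤ 12 * lam * ‖X - 1‖ ^ 2 := by
    have hxe : L (X - 1) = L (exp Y - 1 - Y) := by
      have : X - 1 = (exp Y - 1 - Y) + Y := by rw [hYX]; abel
      rw [this, map_add, hLY, add_zero]
    rw [hxe]
    calc |L (exp Y - 1 - Y)| ≤ lam * ‖exp Y - 1 - Y‖ := hL _
      _ ≤ lam * (3 * ‖Y‖ ^ 2) := mul_le_mul_of_nonneg_left (norm_exp_sub_one_le hY1).1 hlam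
      _ ≤ lam * (3 * (2 * ‖X - 1‖) ^ 2) := by gcongr
      _ = 12 * lam * ‖X - 1‖ ^ 2 := by ring
  have h3 := hR X hX
  rw [hId X hX]
  have hsq : 0 ≤ ‖X - 1‖ ^ 2 := sq_nonneg _
  rw [abs_le] at hLX h3
  nlinarith

/-- **Minimality at `Aᴴ` pins `A` near `1`**: if `Φ(X) = -Re tr(A X) - ε W(X)` with `A` unitary,
`|W 1 - W Aᴴ| ≤ K₃` and `Φ 1 ≤ Φ Aᴴ`, then `‖A - 1‖_F² ≤ 2 ε K₃`. [folklore] -/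
theorem sq_norm_sub_one_le_of_minimal {Φ W : Matrix (Fin N) (Fin N) ℂ → ℝ}
    {A : Matrix (Fin N) (Fin N) ℂ} {ε K₃ : ℝ} (hε : 0 ≤ ε)
    (hΦ : ∀ X, Φ X = -(A * X).trace.re - ε * W X) (hAu : A ∈ Matrix.unitaryGroup (Fin N) ℂ)
    (hW3 : |W 1 - W Aᴴ| ≤ K₃) (hmin : Φ 1 ≤ Φ Aᴴ) : ‖A - 1‖ ^ 2 ≤ 2 * ε * K₃ := by
  have hAA : A * Aᴴ = 1 := by
    have := Matrix.mem_unitaryGroup_iff.1 hAu; rwa [Matrix.star_eq_conjTranspose] at this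
  rw [hΦ, hΦ, hAA, mul_one, re_trace_one, re_trace_eq_of_mem_unitaryGroup hAu] at hmin
  have h4 : W 1 - W Aᴴ ≤ K₃ := (le_abs_self _).trans hW3
  nlinarith

/-- Numerical consequence: `δ² ≤ 2εK₃`, `εK₃ ≤ r⁴/(10⁸ Ñ²)` give `δ ≤ r²/(7000 Ñ)`. [folklore] -/
theorem le_of_sq_le_of_small {δ ε K₃ r Ñ : ℝ} (hδ0 : 0 ≤ δ) (hr : 0 < r) (hÑ : 0 < Ñ)
    (hδ : δ ^ 2 ≤ 2 * ε * K₃) (hεK₃ : ε * K₃ ≤ r ^ 4 / (10 ^ 8 * Ñ ^ 2)) :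
    δ ≤ r ^ 2 / (7000 * Ñ) := by
  have h : δ ^ 2 ≤ (r ^ 2 / (7000 * Ñ)) ^ 2 := by
    refine hδ.trans ?_
    have : 2 * ε * K₃ ≤ 2 * (r ^ 4 / (10 ^ 8 * Ñ ^ 2)) := by nlinarith
    refine this.trans ?_
    rw [div_pow, mul_pow, mul_div_assoc', div_le_div_iff₀ (by positivity) (by positivity)]
    ring_nf
    nlinarith [mul_nonneg (pow_nonneg hr.le 4) (pow_nonneg hÑ.le 2)]
  exact (pow_le_pow_iff_left₀ hδ0 (by positivity) two_ne_zero).1 h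

/-- **Lower Morse bound far from `1`** (pure bookkeeping): with
`Φ X - Φ 1 = ½‖X - 1‖² - ℓ - w`, `|ℓ| ≤ r²/3500`, `|w| ≤ r²/10⁸`, `r ≤ ‖X - 1‖`, `‖X - 1‖² ≤ 4Ñ`:
`r²/(16Ñ) ‖X - 1‖² ≤ Φ X - Φ 1`. [folklore] -/
theorem morse_lower_far {P nX ℓ w r Ñ : ℝ} (hr : 0 < r) (hÑ : 0 < Ñ)
    (hraw : P = (1 / 2) * nX ^ 2 - ℓ - w) (hℓ : |ℓ| ≤ r ^ 2 / 3500) (hw : |w| ≤ r ^ 2 / 10 ^ 8)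
    (hfar : r ≤ nX) (hnX : nX ^ 2 ≤ 4 * Ñ) : r ^ 2 / (16 * Ñ) * nX ^ 2 ≤ P := by
  have hfar2 : r ^ 2 ≤ nX ^ 2 := pow_le_pow_left₀ hr.le hfar 2
  have ha : r ^ 2 / (16 * Ñ) * nX ^ 2 ≤ r ^ 2 / 4 := by
    calc r ^ 2 / (16 * Ñ) * nX ^ 2 ≤ r ^ 2 / (16 * Ñ) * (4 * Ñ) :=
          mul_le_mul_of_nonneg_left hnX (by positivity)
      _ = r ^ 2 / 4 := by field_simp; ring
  rw [abs_le] at hℓ hw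
  rw [hraw]
  nlinarith

/-- **The linear part of the re-centred exponent.** For `Φ(X) = -Re tr(A X) - ε W(X)` and a
real-linear first-order part `D_W` of `W`, the functional `L = -Re tr((A - 1)·) - ε D_W` satisfies
`|L Z| ≤ (‖A - 1‖_F + ε K₁)‖Z‖_F` and, on `U(N)` (where `Re tr Y = N - ½‖Y - 1‖_F²`),
`Φ Y - Φ 1 = ½‖Y - 1‖² + L(Y - 1) - ε (W Y - W 1 - D_W(Y - 1))`. [folklore] -/
theorem exists_linear_part {W Φ : Matrix (Fin N) (Fin N) ℂ → ℝ}
    {DW : Matrix (Fin N) (Fin N) ℂ →ₗ[ℝ] ℝ} {A : Matrix (Fin N) (Fin N) ℂ} {ε K₁ : ℝ} (hε : 0 ≤ ε)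
    (hW1 : ∀ Z, |DW Z| ≤ K₁ * ‖Z‖) (hΦ : ∀ X, Φ X = -(A * X).trace.re - ε * W X) :
    ∃ L : Matrix (Fin N) (Fin N) ℂ →ₗ[ℝ] ℝ,
      (∀ Z, L Z = -((A - 1) * Z).trace.re - ε * DW Z) ∧
      (∀ Z, |L Z| ≤ (‖A - 1‖ + ε * K₁) * ‖Z‖) ∧
      ∀ Y ∈ Matrix.unitaryGroup (Fin N) ℂ,
        Φ Y - Φ 1 = (1 / 2) * ‖Y - 1‖ ^ 2 + L (Y - 1) - ε * (W Y - W 1 - DW (Y - 1)) := by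
  let T : Matrix (Fin N) (Fin N) ℂ →ₗ[ℝ] ℝ :=
    { toFun := fun Y => Y.trace.re
      map_add' := fun Y Y' => by rw [Matrix.trace_add, Complex.add_re]
      map_smul' := fun c Y => by
        rw [Matrix.trace_smul, RingHom.id_apply, Complex.real_smul, Complex.re_ofReal_mul,
          smul_eq_mul] }
  let L : Matrix (Fin N) (Fin N) ℂ →ₗ[ℝ] ℝ := -(T ∘ₗ LinearMap.mulLeft ℝ (A - 1)) - ε • DW
  have hLapply : ∀ Z, L Z = -((A - 1) * Z).trace.re - ε * DW Z := fun Z => by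
    simp only [L, T, LinearMap.sub_apply, LinearMap.neg_apply, LinearMap.comp_apply,
      LinearMap.mulLeft_apply, LinearMap.smul_apply, LinearMap.coe_mk, AddHom.coe_mk, smul_eq_mul]
  refine ⟨L, hLapply, fun Z => ?_, fun Y hY => ?_⟩
  · rw [hLapply]
    have h1 : |((A - 1) * Z).trace.re| ≤ ‖A - 1‖ * ‖Z‖ := by
      have := abs_re_trace_mul_le (A - 1) Z
      rwa [frobNorm_eq_norm, frobNorm_eq_norm] at this
    have h2 : |ε * DW Z| ≤ ε * (K₁ * ‖Z‖) := by
      rw [abs_mul, abs_of_nonneg hε]; exact mul_le_mul_of_nonneg_left (hW1 Z) hε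
    calc |-((A - 1) * Z).trace.re - ε * DW Z| = |((A - 1) * Z).trace.re + ε * DW Z| := by
          rw [← neg_add', abs_neg]
      _ ≤ |((A - 1) * Z).trace.re| + |ε * DW Z| := abs_add_le _ _
      _ ≤ ‖A - 1‖ * ‖Z‖ + ε * (K₁ * ‖Z‖) := add_le_add h1 h2
      _ = (‖A - 1‖ + ε * K₁) * ‖Z‖ := by ring
  · have e1 : (A * Y).trace.re - (A * 1).trace.re =
        ((A - 1) * (Y - 1)).trace.re + (Y.trace.re - (1 : Matrix (Fin N) (Fin N) ℂ).trace.re) := by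
      simp only [mul_sub, sub_mul, one_mul, mul_one, Matrix.trace_sub, Complex.sub_re]
      ring
    have e2 := re_trace_eq_of_mem_unitaryGroup hY
    rw [hΦ, hΦ, hLapply]
    rw [re_trace_one] at e1
    linear_combination -e1 - e2

/-- **Morse bounds at the minimiser** (see the module docstring): for a set `H ⊆ U(N)` closed under
`ᴴ` with an exponential chart of radius `r ≤ ½` at `1`, a perturbation `W` with first-order part
`D_W` (`|D_W Z| ≤ K₁‖Z‖_F`, remainder `≤ K₂‖X - 1‖_F²` on `U(N)`) and oscillation `≤ K₃` on `U(N)`,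
`A ∈ H`, `0 ≤ ε ≤ r⁴/(10⁸ (N+1)² (K₁+K₂+K₃+1))`, and `Φ(X) = -Re tr(A X) - ε W(X)` minimal over `H`
at `1`: `r²/(16(N+1)) ‖X - 1‖_F² ≤ Φ X - Φ 1 ≤ 2 ‖X - 1‖_F²` for every `X ∈ H`. [folklore] -/
theorem morse_bounds {H : Set (Matrix (Fin N) (Fin N) ℂ)}
    (hHU : ∀ X ∈ H, X ∈ Matrix.unitaryGroup (Fin N) ℂ) (hstar : ∀ X ∈ H, Xᴴ ∈ H)
    {r : ℝ} (hr : 0 < r) (hr2 : r ≤ 1 / 2)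
    (hchart : ∀ X ∈ H, ‖X - 1‖ < r → ∃ Y : Matrix (Fin N) (Fin N) ℂ,
      (∀ t : ℝ, exp (t • Y) ∈ H) ∧ exp Y = X ∧ ‖Y‖ ≤ 2 * ‖X - 1‖)
    {K₁ K₂ K₃ : ℝ} (hK₁ : 0 ≤ K₁) (hK₂ : 0 ≤ K₂) (hK₃ : 0 ≤ K₃)
    {W : Matrix (Fin N) (Fin N) ℂ → ℝ} {DW : Matrix (Fin N) (Fin N) ℂ →ₗ[ℝ] ℝ}
    (hW1 : ∀ Z, |DW Z| ≤ K₁ * ‖Z‖)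
    (hW2 : ∀ X ∈ Matrix.unitaryGroup (Fin N) ℂ, |W X - W 1 - DW (X - 1)| ≤ K₂ * ‖X - 1‖ ^ 2)
    (hW3 : ∀ X ∈ Matrix.unitaryGroup (Fin N) ℂ, ∀ X' ∈ Matrix.unitaryGroup (Fin N) ℂ,
      |W X - W X'| ≤ K₃)
    {A : Matrix (Fin N) (Fin N) ℂ} (hA : A ∈ H) {ε : ℝ} (hε : 0 ≤ ε)
    (hε₀ : ε ≤ r ^ 4 / (10 ^ 8 * ((N : ℝ) + 1) ^ 2 * (K₁ + K₂ + K₃ + 1)))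
    {Φ : Matrix (Fin N) (Fin N) ℂ → ℝ} (hΦ : ∀ X, Φ X = -(A * X).trace.re - ε * W X)
    (hmin : ∀ X ∈ H, Φ 1 ≤ Φ X) {X : Matrix (Fin N) (Fin N) ℂ} (hX : X ∈ H) :
    r ^ 2 / (16 * ((N : ℝ) + 1)) * ‖X - 1‖ ^ 2 ≤ Φ X - Φ 1 ∧ Φ X - Φ 1 ≤ 2 * ‖X - 1‖ ^ 2 := by
  -- constants
  set Ñ : ℝ := (N : ℝ) + 1 with hÑ
  set K : ℝ := K₁ + K₂ + K₃ + 1 with hK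
  have hÑ1 : 1 ≤ Ñ := by rw [hÑ]; linarith [(Nat.cast_nonneg N : (0 : ℝ) ≤ N)]
  have hÑpos : 0 < Ñ := by linarith
  have hÑne : Ñ ≠ 0 := hÑpos.ne'
  have hK1 : 1 ≤ K := by rw [hK]; linarith
  have hsN : Real.sqrt N ≤ Ñ := sqrt_natCast_le_add_one N
  have hr1 : r ^ 2 ≤ 1 := pow_le_one₀ hr.le (by linarith)
  have hr4 : r ^ 4 ≤ 1 := pow_le_one₀ hr.le (by linarith)
  have hr42 : r ^ 4 ≤ r ^ 2 := by
    calc r ^ 4 = r ^ 2 * r ^ 2 := by ring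
      _ ≤ r ^ 2 * 1 := mul_le_mul_of_nonneg_left hr1 (sq_nonneg r)
      _ = r ^ 2 := mul_one _
  have hεK : ε * K ≤ r ^ 4 / (10 ^ 8 * Ñ ^ 2) := by
    have h := mul_le_mul_of_nonneg_right hε₀ (by positivity : (0 : ℝ) ≤ K)
    rwa [div_mul_eq_mul_div, mul_div_mul_right _ _ (by positivity : K ≠ 0)] at h
  have hεK' : ε * K ≤ r ^ 4 / 10 ^ 8 := by
    refine hεK.trans ?_
    rw [div_le_div_iff_of_pos_left (by positivity) (by positivity) (by positivity)]
    nlinarith only [hÑ1]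
  have hεK₁ : ε * K₁ ≤ r ^ 4 / 10 ^ 8 := (mul_le_mul_of_nonneg_left (by linarith) hε).trans hεK'
  have hεK₂ : ε * K₂ ≤ r ^ 4 / 10 ^ 8 := (mul_le_mul_of_nonneg_left (by linarith) hε).trans hεK'
  have hεK₃ : ε * K₃ ≤ r ^ 4 / (10 ^ 8 * Ñ ^ 2) :=
    (mul_le_mul_of_nonneg_left (by linarith) hε).trans hεK
  have hεK₃' : ε * K₃ ≤ r ^ 4 / 10 ^ 8 := (mul_le_mul_of_nonneg_left (by linarith) hε).trans hεK'
  -- unitarity facts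
  have hAu := hHU A hA
  have hXu := hHU X hX
  have h1u : (1 : Matrix (Fin N) (Fin N) ℂ) ∈ Matrix.unitaryGroup (Fin N) ℂ := Submonoid.one_mem _
  have hsu : ∀ {Y : Matrix (Fin N) (Fin N) ℂ}, Y ∈ Matrix.unitaryGroup (Fin N) ℂ →
      Yᴴ ∈ Matrix.unitaryGroup (Fin N) ℂ := fun hY => by
    rw [← Matrix.star_eq_conjTranspose]; exact Unitary.star_mem hY
  -- the real-linear functional `L`
  obtain ⟨L, hLapply, hLbound', hId⟩ := exists_linear_part hε hW1 hΦ
  set δ : ℝ := ‖A - 1‖ with hδdef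
  set lam : ℝ := δ + ε * K₁ with hlam
  have hlam0 : 0 ≤ lam := by positivity
  have hLbound : ∀ Z, |L Z| ≤ lam * ‖Z‖ := hLbound'
  have hR : ∀ Y ∈ Matrix.unitaryGroup (Fin N) ℂ,
      |ε * (W Y - W 1 - DW (Y - 1))| ≤ ε * K₂ * ‖Y - 1‖ ^ 2 := fun Y hY => by
    rw [abs_mul, abs_of_nonneg hε, mul_assoc]
    exact mul_le_mul_of_nonneg_left (hW2 Y hY) hε
  -- Step 1: `‖A - 1‖² ≤ 2 ε K₃`, hence `δ` is small
  have hδ : δ ^ 2 ≤ 2 * ε * K₃ :=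
    sq_norm_sub_one_le_of_minimal hε hΦ hAu (hW3 1 h1u Aᴴ (hsu hAu)) (hmin Aᴴ (hstar A hA))
  have hδ₀ : δ ≤ r ^ 2 / (7000 * Ñ) := le_of_sq_le_of_small (norm_nonneg _) hr hÑpos hδ hεK₃
  have hδ₀' : δ ≤ r ^ 2 / 7000 := by
    refine hδ₀.trans ?_
    rw [div_le_div_iff_of_pos_left (by positivity) (by positivity) (by positivity)]
    nlinarith only [hÑ1]
  -- Step 2: the upper bound
  have hup : Φ X - Φ 1 ≤ 2 * ‖X - 1‖ ^ 2 :=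
    morse_upper hlam0 hId hLbound hR (by rw [hlam]; linarith) hXu (hmin Xᴴ (hstar X hX))
  refine ⟨?_, hup⟩
  -- Step 3: the lower bound
  by_cases hnear : ‖X - 1‖ < r
  · obtain ⟨Y, hYH, hYX, hYn⟩ := hchart X hX hnear
    have hY1 : ‖Y‖ ≤ 1 := by linarith
    have hLY : L Y = 0 :=
      apply_eq_zero_of_minimal_along hlam0 (by positivity) hId hLbound hR
        (fun t => hHU _ (hYH t)) (fun t => hmin _ (hYH t))
    have hlow := morse_lower_near hlam0 hId hLbound hR (by rw [hlam]; linarith) hXu hYX hYn hY1 hLY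
    have ha : r ^ 2 / (16 * Ñ) ≤ 1 / 4 := by
      rw [div_le_div_iff₀ (by positivity) (by positivity)]; nlinarith only [hr1, hÑ1]
    linarith only [hlow, mul_le_mul_of_nonneg_right ha (sq_nonneg ‖X - 1‖)]
  · push Not at hnear
    -- `Φ X - Φ 1 = ½‖X-1‖² - Re tr((A-1)(X-1)) - ε (W X - W 1)`
    have hraw : Φ X - Φ 1 =
        (1 / 2) * ‖X - 1‖ ^ 2 - ((A - 1) * (X - 1)).trace.re - ε * (W X - W 1) := by
      rw [hId X hXu, hLapply]; ring
    have h1 : |((A - 1) * (X - 1)).trace.re| ≤ δ * (2 * Real.sqrt N) := by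
      have := abs_re_trace_mul_le (A - 1) (X - 1)
      rw [frobNorm_eq_norm, frobNorm_eq_norm] at this
      refine this.trans (mul_le_mul_of_nonneg_left ?_ (norm_nonneg _))
      exact norm_sub_one_le_of_norm_le (norm_of_mem_unitaryGroup hXu).le
    have h2 : |ε * (W X - W 1)| ≤ ε * K₃ := by
      rw [abs_mul, abs_of_nonneg hε]
      exact mul_le_mul_of_nonneg_left (hW3 X hXu 1 h1u) hε
    have h4 : δ * (2 * Real.sqrt N) ≤ r ^ 2 / 3500 := by
      calc δ * (2 * Real.sqrt N) ≤ r ^ 2 / (7000 * Ñ) * (2 * Ñ) := by gcongr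
        _ = r ^ 2 / 3500 := by field_simp; ring
    have h5 : ε * K₃ ≤ r ^ 2 / 10 ^ 8 := by
      refine hεK₃'.trans ?_
      rw [div_le_div_iff₀ (by positivity) (by positivity)]
      linarith only [hr42]
    have hXn : ‖X - 1‖ ^ 2 ≤ 4 * Ñ := by
      have h := norm_sub_one_le_of_norm_le (norm_of_mem_unitaryGroup hXu).le
      have h' : ‖X - 1‖ ^ 2 ≤ (2 * Real.sqrt N) ^ 2 := pow_le_pow_left₀ (norm_nonneg _) h 2
      have hsq : (2 * Real.sqrt (N : ℝ)) ^ 2 = 4 * N := by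
        rw [mul_pow, Real.sq_sqrt (Nat.cast_nonneg _)]; norm_num
      linarith only [h', hsq, hÑ]
    exact morse_lower_far hr hÑpos hraw (h1.trans h4) (h2.trans h5) hnear hXn

end Literature.MathematicalPhysics.QuantumFieldTheory

end
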